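import Mathlib
import Summits.ValiantsHypothesis.ValiantsHypothesis.Theorems.FifoMatchingNNDivisionHardManyArcFaces
import HarnessLib

/-!
# Route FifoMatching — crux `NNDivisionHard` (stmt-ValiantsHypothesis-21181): the NEWTON-DIMENSION DESCENT, file 1 of 2 —
# the single step (pinning a coordinate of the cofactor; arc-avoiding faces are stable under the directions `𝟙_{≠ e}`)

The genericity rungs of the tree (`…ArcElimination`, `…FewArcFaces`, `…ManyArcFaces`, `…PowerSums`, …) test ONE direction
`𝟙_{I^c}`: if the outer `I`-face `top_{𝟙_{I^c}} h` of the cofactor is a single monomial, the certificate computes the hard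
face `NN_n^{¬I}`.  The descent (file 2, `…NewtonDimension.lean`) iterates the test ARC BY ARC in directions `𝟙_{≠ e}` chosen by
the cofactor; this file proves the three ingredients of one step:

* §1 (linear algebra in `ℚ^{arcs}`) `finrank_vectorSpan_lt_of_pinned` — if every point of `S' ⊆ S` has the same `e`-th
  coordinate while two points of `S` differ there, `dim aff S' < dim aff S`; `finrank_vectorSpan_pos`;
  `finrank_vectorSpan_image_le_card_pred` (`m + 1` exponents span dimension `≤ m`); `finrank_vectorSpan_image_le_of_lattice`
  (exponents on a translated lattice `u₀ + ℕ v₁ + ⋯ + ℕ v_D` span dimension `≤ D`);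
* §2 (cofactor side) `weight_ne_add` (`weight_{𝟙_{≠e}} u + u e = |u|`), ★ `apply_eq_of_mem_support_topComponent` — for a
  HOMOGENEOUS `g` all monomials of the free initial form `top_{𝟙_{≠e}} g` have the same exponent at `e` (PINNING);
  homogeneity is inherited (`isWeightedHomogeneous_topComponent`, `isWeightedHomogeneous_topComponent_one`);
  `eq_monomial_of_support_eq_singleton`, `exists_apply_ne_of_not_singleton`;
* §3 (matching side) ★ `topComponent_face_insert` — `top_{𝟙_{≠e}} NN_n^{¬I} = NN_n^{¬(I ∪ {e})}` if some nest-free perfect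
  matching avoids `I ∪ {e}`; ★ `topComponent_face_self` — `= NN_n^{¬I}` otherwise (every member contains `e`, weight `n − 1`);
  `face_empty_eq` (`NN_n^{¬∅} = NN_n`).

HONEST FRAMING: step lemmas toward ONE rung of ONE crux; stmt-21181 stays OPEN; nothing here bears on `NNNotVP` or on
VP ≠ VNP (NOT proved).  No definitions, no named facts.
References: Bürgisser 2000 Rem. 2.7 [Burgisser2000]; Hrubeš–Yehudayoff 2021 §6 Problem 2 [HrubesYehudayoff2021].
-/

noncomputable section

-- Sub = Summit single-conjunct layout: the duplicated namespace component is mandated by the tree.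
set_option linter.dupNamespace false
set_option autoImplicit false

namespace Summit.ValiantsHypothesis.ValiantsHypothesis.Theorems.FifoMatching.NNDivisionHard.NewtonDimensionSteps

open Finset MvPolynomial Literature.Computability.AlgebraicComplexity
open Summit.ValiantsHypothesis.ValiantsHypothesis.Theorems.ZeroOneTransfer.Negative
  (topComponent support_topComponent_subset coeff_topComponent)
open Summit.ValiantsHypothesis.ValiantsHypothesis.Theorems.FifoMatching.NNDivisionHard.LocalCofactor
  (weight_le weight_eq_iff weight_eq_card)
open Summit.ValiantsHypothesis.ValiantsHypothesis.Theorems.FifoMatching.NNDivisionHard.StackPowersQueue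
  (topComponent_sum_arcMonomial)
open scoped NNReal BigOperators

/-! ### §1 Linear algebra of the descent: pinning a coordinate lowers the dimension of the affine span -/

section LinAlg

variable {σ : Type*} [Fintype σ]

/-- If every point of `S' ⊆ S` has the same `e`-th coordinate while two points of `S` differ there, then
`dim aff S' < dim aff S`. [folklore] -/
theorem finrank_vectorSpan_lt_of_pinned {S S' : Set (σ → ℚ)} (hS'S : S' ⊆ S) (e : σ)
    (hpin : ∀ p ∈ S', ∀ q ∈ S', p e = q e) {p₀ q₀ : σ → ℚ} (hp₀ : p₀ ∈ S) (hq₀ : q₀ ∈ S)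
    (hne : p₀ e ≠ q₀ e) :
    Module.finrank ℚ (vectorSpan ℚ S') < Module.finrank ℚ (vectorSpan ℚ S) := by
  apply Submodule.finrank_lt_finrank_of_lt
  refine lt_of_le_of_ne (vectorSpan_mono ℚ hS'S) fun hEq => hne ?_
  have hmem : p₀ -ᵥ q₀ ∈ vectorSpan ℚ S' := hEq ▸ vsub_mem_vectorSpan ℚ hp₀ hq₀
  have hker : vectorSpan ℚ S' ≤ LinearMap.ker (LinearMap.proj e : (σ → ℚ) →ₗ[ℚ] ℚ) := by
    rw [vectorSpan_def]
    refine Submodule.span_le.2 ?_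
    intro v hv
    obtain ⟨p, hp, q, hq, rfl⟩ := Set.mem_vsub.1 hv
    simp [vsub_eq_sub, hpin p hp q hq]
  have h0 := hker hmem
  simp only [LinearMap.mem_ker, LinearMap.coe_proj, Function.eval, vsub_eq_sub, Pi.sub_apply] at h0
  exact sub_eq_zero.1 h0

/-- Two distinct points span a positive-dimensional affine space. [folklore] -/
theorem finrank_vectorSpan_pos {S : Set (σ → ℚ)} {p₀ q₀ : σ → ℚ} (hp₀ : p₀ ∈ S) (hq₀ : q₀ ∈ S)
    (hne : p₀ ≠ q₀) : 0 < Module.finrank ℚ (vectorSpan ℚ S) := by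
  rw [Module.finrank_pos_iff_exists_ne_zero]
  refine ⟨⟨p₀ -ᵥ q₀, vsub_mem_vectorSpan ℚ hp₀ hq₀⟩, ?_⟩
  simp [vsub_eq_sub, sub_eq_zero, hne]

/-- `m + 1` points span an affine space of dimension `≤ m` (the support of a polynomial, read in `ℚ^σ`). [folklore] -/
theorem finrank_vectorSpan_image_le_card_pred (T : Finset (σ →₀ ℕ)) (hT : T.Nonempty) :
    Module.finrank ℚ (vectorSpan ℚ ((fun u : σ →₀ ℕ => fun a : σ => (u a : ℚ)) '' (T : Set (σ →₀ ℕ)))) ≤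
      T.card - 1 := by
  classical
  rw [← Finset.coe_image]
  exact finrank_vectorSpan_image_finset_le ℚ _ T (by have := hT.card_pos; omega)

/-- Points of a translated lattice `u₀ + ℕ v₁ + ⋯ + ℕ v_D` span an affine space of dimension `≤ D`. [folklore] -/
theorem finrank_vectorSpan_image_le_of_lattice {D : ℕ} (u₀ : σ →₀ ℕ) (v : Fin D → (σ →₀ ℕ))
    (T : Set (σ →₀ ℕ)) (hT : ∀ u ∈ T, ∃ a : Fin D → ℕ, u = u₀ + ∑ k, a k • v k) :
    Module.finrank ℚ (vectorSpan ℚ ((fun u : σ →₀ ℕ => fun a : σ => (u a : ℚ)) '' T)) ≤ D := by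
  classical
  set cast : (σ →₀ ℕ) → (σ → ℚ) := fun u a => (u a : ℚ) with hcast
  have hle : vectorSpan ℚ (cast '' T) ≤ Submodule.span ℚ (Set.range fun k : Fin D => cast (v k)) := by
    rw [vectorSpan_def]
    refine Submodule.span_le.2 ?_
    intro x hx
    obtain ⟨p, hp, q, hq, rfl⟩ := Set.mem_vsub.1 hx
    obtain ⟨u, hu, rfl⟩ := hp
    obtain ⟨u', hu', rfl⟩ := hq
    obtain ⟨a, rfl⟩ := hT u hu
    obtain ⟨a', rfl⟩ := hT u' hu'
    have hrepr : cast (u₀ + ∑ k, a k • v k) -ᵥ cast (u₀ + ∑ k, a' k • v k) =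
        ∑ k, ((a k : ℚ) - (a' k : ℚ)) • cast (v k) := by
      funext x
      simp only [hcast, vsub_eq_sub, Pi.sub_apply, Finsupp.coe_add, Finsupp.coe_finsetSum, Pi.add_apply,
        Finset.sum_apply, Finsupp.coe_smul, Pi.smul_apply, smul_eq_mul, Nat.cast_add, Nat.cast_sum,
        Nat.cast_mul, sub_mul, Finset.sum_sub_distrib]
      ring
    rw [hrepr]
    exact Submodule.sum_mem _ fun k _ => Submodule.smul_mem _ _ (Submodule.subset_span ⟨k, rfl⟩)
  exact (Submodule.finrank_mono hle).trans ((finrank_range_le_card _).trans (by simp))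

end LinAlg

/-! ### §2 The cofactor side: initial forms in direction `𝟙_{≠ e}` of a homogeneous polynomial are pinned at `e` -/

section Poly

variable {σ : Type*}

/-- `weight_{𝟙_{≠e}}(u) + u(e) = |u|`. [folklore] -/
theorem weight_ne_add [DecidableEq σ] (e : σ) (u : σ →₀ ℕ) :
    Finsupp.weight (fun a : σ => if a ∈ ({e} : Finset σ) then 0 else 1) u + u e =
      Finsupp.weight (1 : σ → ℕ) u := by
  classical
  simp only [Finsupp.weight_apply, Finsupp.sum, Finset.mem_singleton, smul_eq_mul, Pi.one_apply, mul_one,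
    mul_ite, mul_zero]
  have he : (u e : ℕ) = ∑ a ∈ u.support, if a = e then u a else 0 := by
    rw [Finset.sum_ite_eq' u.support e]
    split_ifs with h
    · rfl
    · exact Finsupp.notMem_support_iff.1 h
  rw [he, ← Finset.sum_add_distrib]
  refine Finset.sum_congr rfl fun a _ => ?_
  split_ifs <;> simp

/-- A sub-sum of a `𝟙`-homogeneous polynomial is `𝟙`-homogeneous: initial forms of homogeneous polynomials are homogeneous
of the same degree. [folklore] -/
theorem isWeightedHomogeneous_topComponent {g : MvPolynomial σ ℝ≥0} {N : ℕ}
    (hg : IsWeightedHomogeneous (1 : σ → ℕ) g N) (w : σ → ℕ) :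
    IsWeightedHomogeneous (1 : σ → ℕ) (topComponent w g) N := by
  intro d hd
  exact hg (mem_support_iff.1 (support_topComponent_subset w g (mem_support_iff.2 hd)))

/-- The total-degree initial form `top_𝟙 h` is homogeneous (of degree the total degree of `h`). [folklore] -/
theorem isWeightedHomogeneous_topComponent_one (h : MvPolynomial σ ℝ≥0) :
    IsWeightedHomogeneous (1 : σ → ℕ) (topComponent (1 : σ → ℕ) h) (weightedTotalDegree (1 : σ → ℕ) h) := by
  intro d hd
  rw [coeff_topComponent] at hd
  split_ifs at hd with hwt
  · exact hwt
  · exact absurd rfl hd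

/-- ★ **PINNING.**  For a homogeneous `g`, all monomials of `top_{𝟙_{≠e}} g` have the same exponent at `e` (they have the same
total degree and the same weight off `e`). [folklore] -/
theorem apply_eq_of_mem_support_topComponent [DecidableEq σ] {g : MvPolynomial σ ℝ≥0} {N : ℕ}
    (hg : IsWeightedHomogeneous (1 : σ → ℕ) g N) (e : σ) {u u' : σ →₀ ℕ}
    (hu : u ∈ (topComponent (fun a : σ => if a ∈ ({e} : Finset σ) then 0 else 1) g).support)
    (hu' : u' ∈ (topComponent (fun a : σ => if a ∈ ({e} : Finset σ) then 0 else 1) g).support) :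
    u e = u' e := by
  set w : σ → ℕ := fun a : σ => if a ∈ ({e} : Finset σ) then 0 else 1 with hw
  have h1 : ∀ v ∈ (topComponent w g).support, Finsupp.weight w v = weightedTotalDegree w g ∧ v ∈ g.support := by
    intro v hv
    rw [mem_support_iff, coeff_topComponent] at hv
    split_ifs at hv with hwt
    · exact ⟨hwt, mem_support_iff.2 hv⟩
    · exact absurd rfl hv
  obtain ⟨hwu, hug⟩ := h1 u hu
  obtain ⟨hwu', hu'g⟩ := h1 u' hu'
  have hNu : Finsupp.weight (1 : σ → ℕ) u = N := hg (mem_support_iff.1 hug)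
  have hNu' : Finsupp.weight (1 : σ → ℕ) u' = N := hg (mem_support_iff.1 hu'g)
  have h2 : Finsupp.weight w u + u e = Finsupp.weight (1 : σ → ℕ) u := weight_ne_add e u
  have h3 : Finsupp.weight w u' + u' e = Finsupp.weight (1 : σ → ℕ) u' := weight_ne_add e u'
  omega

/-- A polynomial with singleton support is a monomial. [folklore] -/
theorem eq_monomial_of_support_eq_singleton {g : MvPolynomial σ ℝ≥0} {d : σ →₀ ℕ} (hd : g.support = {d}) :
    g = monomial d (coeff d g) := by
  conv_lhs => rw [g.as_sum, hd, Finset.sum_singleton]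

/-- A nonzero polynomial that is not a monomial has two monomials differing at some variable. [folklore] -/
theorem exists_apply_ne_of_not_singleton {g : MvPolynomial σ ℝ≥0} (hg0 : g ≠ 0)
    (hns : ¬ ∃ d : σ →₀ ℕ, g.support = {d}) :
    ∃ u ∈ g.support, ∃ u' ∈ g.support, ∃ e : σ, u e ≠ u' e := by
  obtain ⟨d₀, hd₀⟩ := support_nonempty.2 hg0
  have : ∃ u ∈ g.support, u ≠ d₀ := by
    by_contra hc
    push Not at hc
    exact hns ⟨d₀, Finset.eq_singleton_iff_unique_mem.2 ⟨hd₀, hc⟩⟩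
  obtain ⟨u, hu, hne⟩ := this
  obtain ⟨e, he⟩ := DFunLike.ne_iff.1 hne
  exact ⟨u, hu, d₀, hd₀, e, he⟩

end Poly

/-! ### §3 The matching side: arc-avoiding faces are stable under the directions `𝟙_{≠ e}` -/

section Faces

variable {n : ℕ}

/-- ★ If some nest-free perfect matching avoids `I ∪ {e}`, then `top_{𝟙_{≠e}} NN_n^{¬I} = NN_n^{¬(I ∪ {e})}`. [folklore] -/
theorem topComponent_face_insert (I : Finset (Fin (2 * n) × Fin (2 * n))) (e : Fin (2 * n) × Fin (2 * n))
    (hIe : ∃ M ∈ nestFreeMatchings (2 * n), ∀ i ∈ openers M, (i, M i) ∉ insert e I) :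
    topComponent (fun a : Fin (2 * n) × Fin (2 * n) => if a ∈ ({e} : Finset (Fin (2 * n) × Fin (2 * n))) then 0 else 1)
      (∑ M ∈ (nestFreeMatchings (2 * n)).filter (fun M => ∀ i ∈ openers M, (i, M i) ∉ I), arcMonomial ℝ≥0 M) =
      ∑ M ∈ (nestFreeMatchings (2 * n)).filter (fun M => ∀ i ∈ openers M, (i, M i) ∉ insert e I),
        arcMonomial ℝ≥0 M := by
  classical
  obtain ⟨M₀, hM₀, hM₀I⟩ := hIe
  have hS : (nestFreeMatchings (2 * n)).filter (fun M => ∀ i ∈ openers M, (i, M i) ∉ I) ⊆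
      perfectMatchings (2 * n) :=
    (Finset.filter_subset _ _).trans nestFreeMatchings_subset_perfectMatchings
  have hM₀S : M₀ ∈ (nestFreeMatchings (2 * n)).filter (fun M => ∀ i ∈ openers M, (i, M i) ∉ I) :=
    Finset.mem_filter.2 ⟨hM₀, fun i hi hmem => hM₀I i hi (Finset.mem_insert_of_mem hmem)⟩
  have hM₀w : Finsupp.weight (fun a : Fin (2 * n) × Fin (2 * n) =>
      if a ∈ ({e} : Finset (Fin (2 * n) × Fin (2 * n))) then 0 else 1) (arcExponent M₀) = n :=
    (weight_eq_iff {e} (nestFreeMatchings_subset_perfectMatchings hM₀)).2 fun i hi hmem =>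
      hM₀I i hi (by rw [Finset.mem_singleton] at hmem; rw [hmem]; exact Finset.mem_insert_self _ _)
  rw [topComponent_sum_arcMonomial _ hS (W := n) (fun M hM => weight_le {e} (hS hM)) ⟨M₀, hM₀S, hM₀w⟩,
    Finset.filter_filter]
  refine Finset.sum_congr (Finset.filter_congr fun M hM => ?_) fun _ _ => rfl
  rw [weight_eq_iff {e} (nestFreeMatchings_subset_perfectMatchings hM)]
  simp only [Finset.mem_insert, Finset.mem_singleton, not_or]
  constructor
  · rintro ⟨h1, h2⟩ i hi
    exact ⟨h2 i hi, h1 i hi⟩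
  · intro h
    exact ⟨fun i hi => (h i hi).2, fun i hi => (h i hi).1⟩

/-- ★ If some nest-free perfect matching avoids `I` but none avoids `I ∪ {e}` (every member of the face contains the arc `e`),
then `top_{𝟙_{≠e}} NN_n^{¬I} = NN_n^{¬I}`. [folklore] -/
theorem topComponent_face_self (I : Finset (Fin (2 * n) × Fin (2 * n))) (e : Fin (2 * n) × Fin (2 * n))
    (hI : ∃ M ∈ nestFreeMatchings (2 * n), ∀ i ∈ openers M, (i, M i) ∉ I)
    (hIe : ¬ ∃ M ∈ nestFreeMatchings (2 * n), ∀ i ∈ openers M, (i, M i) ∉ insert e I) :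
    topComponent (fun a : Fin (2 * n) × Fin (2 * n) => if a ∈ ({e} : Finset (Fin (2 * n) × Fin (2 * n))) then 0 else 1)
      (∑ M ∈ (nestFreeMatchings (2 * n)).filter (fun M => ∀ i ∈ openers M, (i, M i) ∉ I), arcMonomial ℝ≥0 M) =
      ∑ M ∈ (nestFreeMatchings (2 * n)).filter (fun M => ∀ i ∈ openers M, (i, M i) ∉ I), arcMonomial ℝ≥0 M := by
  classical
  set S := (nestFreeMatchings (2 * n)).filter (fun M => ∀ i ∈ openers M, (i, M i) ∉ I) with hS_def
  have hS : S ⊆ perfectMatchings (2 * n) :=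
    (Finset.filter_subset _ _).trans nestFreeMatchings_subset_perfectMatchings
  -- every member of the face contains `e`, hence has weight `n - 1`
  have hw : ∀ M ∈ S, Finsupp.weight (fun a : Fin (2 * n) × Fin (2 * n) =>
      if a ∈ ({e} : Finset (Fin (2 * n) × Fin (2 * n))) then 0 else 1) (arcExponent M) = n - 1 := by
    intro M hM
    obtain ⟨hMnf, hMI⟩ := Finset.mem_filter.1 hM
    have hPM := nestFreeMatchings_subset_perfectMatchings hMnf
    have hex : ∃ i₀ ∈ openers M, (i₀, M i₀) = e := by
      by_contra hc
      push Not at hc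
      exact hIe ⟨M, hMnf, fun i hi hmem => by
        rcases Finset.mem_insert.1 hmem with h | h
        · exact hc i hi h
        · exact hMI i hi h⟩
    obtain ⟨i₀, hi₀, hi₀e⟩ := hex
    rw [weight_eq_card {e}]
    have hfilt : (openers M).filter (fun i => (i, M i) ∉ ({e} : Finset (Fin (2 * n) × Fin (2 * n)))) =
        (openers M).erase i₀ := by
      rw [← Finset.filter_ne']
      refine Finset.filter_congr fun i _ => ?_
      rw [Finset.mem_singleton]
      constructor
      · intro h hEq
        exact h (by rw [hEq, hi₀e])
      · intro h hEq
        apply h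
        rw [← hi₀e] at hEq
        exact (Prod.mk.inj hEq).1
    rw [hfilt, Finset.card_erase_of_mem hi₀, card_openers hPM]
  obtain ⟨M₀, hM₀, hM₀I⟩ := hI
  have hM₀S : M₀ ∈ S := Finset.mem_filter.2 ⟨hM₀, hM₀I⟩
  rw [topComponent_sum_arcMonomial _ hS (W := n - 1) (fun M hM => (hw M hM).le) ⟨M₀, hM₀S, hw M₀ hM₀S⟩,
    Finset.filter_true_of_mem hw]

/-- `NN_n^{¬∅} = NN_n`. [folklore] -/
theorem face_empty_eq : (∑ M ∈ (nestFreeMatchings (2 * n)).filter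
      (fun M => ∀ i ∈ openers M, (i, M i) ∉ (∅ : Finset (Fin (2 * n) × Fin (2 * n)))), arcMonomial ℝ≥0 M) =
    nestFreeMatchingPoly n ℝ≥0 := by
  rw [nestFreeMatchingPoly_eq_sum_arcMonomial, Finset.filter_true_of_mem]
  intro M _ i _ h
  exact Finset.notMem_empty _ h

end Faces

end Summit.ValiantsHypothesis.ValiantsHypothesis.Theorems.FifoMatching.NNDivisionHard.NewtonDimensionSteps

end
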